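import Literature.NumberTheory.Sieve.ChenSwitchedCount
import Literature.NumberTheory.Sieve.ChenSwitchedRemainder
import HarnessLib

/-!
# Chen's theorem: the upper bound for the switching term (Nathanson, Thm 10.6) — PROVED

Topic `Literature/NumberTheory/Sieve`. This file discharges the named fact
`Literature.NumberTheory.Sieve.Chen.chen_switched_upper` of `ChenTheorem.lean`
(Nathanson, *Additive Number Theory: The Classical Bases*, GTM 164, Thm 10.6):

  `S(B, 𝒫, y) < (c e^γ/2 + ε) · N V(z)/log N + C N/(log N)³`  for all even `N ≥ N₀(ε)`,

`B = {N − p₁p₂p₃ : z ≤ p₁ < y ≤ p₂ ≤ p₃, p₁p₂p₃ < N, (p₁p₂p₃, N) = 1}`, `z = N^{1/8}`, `y = N^{1/3}`,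
`c = ∫_{1/8}^{1/3} log(2−3β)/(β(1−β)) dβ`.

It assembles the three proved steps of Nathanson's proof:
* the sieve step `switchedSiftedCount_le` (`ChenSwitchedSieve.lean`): enlarge `B` to `B̃` indexed
  by `T̃(N, ε)`, apply the uniform linear sieve (Iwaniec's theorem, proved in the tree) with
  `D = N^{1/2−δ}`, `F(s) = 2e^γ/s`, and `V(y) = (3/8 + o(1)) V(z)` (Mertens);
* the remainder `switchedRemainderExt_le` (`ChenSwitchedRemainder.lean`): Nathanson's (10.15)
  from the bilinear form inequality Thm 10.7 (large sieve + Siegel–Walfisz, proved in the tree);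
* the count `card_switchedTriplesExt_le` (`ChenSwitchedCount.lean`): `#T̃ ≤ (1+ε)²(c+η)N/log N`
  (prime number theorem + Mertens).
With `ε = δ = θ = η = t = min(1/8, ε₀/70)` the constant is
`(e^γ/(2(1−2t)) + t)(1+t)²(c+t) ≤ c e^γ/2 + 33 t ≤ c e^γ/2 + ε₀/2` (`c ≤ 2`, `e^γ ≤ 3`), and the
strict inequality follows from `N V(z)/log N > 0` (`sieveProduct_pos`).

## References

* M. B. Nathanson, *Additive Number Theory: The Classical Bases*, GTM 164 (1996), Thm 10.6,
  pp. 287–290, and Thm 10.7, pp. 290–295. [Nathanson1996]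
-/

open Finset Filter Topology

noncomputable section

namespace Literature.NumberTheory.Sieve.Chen

/-- `V(z) > 0` for even `N`: every factor `1 − 1/(p−1)`, `p ≥ 3`, is at least `1/2`. [folklore] -/
theorem sieveProduct_pos {N : ℕ} (hN : Even N) (w : ℝ) : 0 < sieveProduct N w := by
  unfold sieveProduct
  refine Finset.prod_pos fun p hp => ?_
  rw [Finset.mem_filter, Nat.mem_primesBelow] at hp
  have hp2 : p ≠ 2 := by
    rintro rfl
    exact hp.2 (even_iff_two_dvd.mp hN)
  have h3 : (3 : ℝ) ≤ p := by
    have := hp.1.2.two_le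
    exact_mod_cast (show 3 ≤ p by omega)
  have : 1 / ((p : ℝ) - 1) ≤ 1 / 2 := by
    rw [div_le_div_iff₀ (by linarith) (by norm_num)]; linarith
  linarith

set_option maxHeartbeats 1600000 in
/-- **Nathanson's Theorem 10.6, PROVED** — discharge of the named fact
`Literature.NumberTheory.Sieve.Chen.chen_switched_upper` of `ChenTheorem.lean`: for every `ε > 0` there
are `C, N₀` with
`S(B, 𝒫, y) < (c e^γ/2 + ε) · N V(z)/log N + C N/(log N)³` for all even `N ≥ N₀`
(`z = N^{1/8}`, `y = N^{1/3}`, `V = sieveProduct N`, `c = switchingConstant`).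
Assembly of the three steps: the sieve step `switchedSiftedCount_le` (`ChenSwitchedSieve.lean`:
uniform linear sieve, Iwaniec's theorem as proved in the tree, `F(s) = 2e^γ/s`, `V(y)/V(z) → 3/8`),
the remainder estimate `switchedRemainderExt_le` (`ChenSwitchedRemainder.lean`: (10.15) from the
bilinear form inequality Thm 10.7, large sieve + Siegel–Walfisz, all proved), and the count
`card_switchedTriplesExt_le` (`ChenSwitchedCount.lean`: PNT + Mertens), with
`ε = δ = θ = η = t = min(1/8, ε₀/70)`:
`(e^γ/(2(1−2t)) + t)(1+t)²(c+t) ≤ ce^γ/2 + 33t` (`c ≤ 2`, `e^γ ≤ 3`).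
[cite: Nathanson1996, Thm 10.6] -/
theorem chen_switched_upper_holds : chen_switched_upper := by
  intro ε₀ hε₀
  set G := Real.exp Real.eulerMascheroniConstant with hG
  set c := switchingConstant with hc
  have hc0 : 0 ≤ c := switchingConstant_nonneg
  have hc2 : c ≤ 2 := switchingConstant_le_two
  have hG0 : 0 < G := Real.exp_pos _
  have hG3 : G ≤ 3 := by
    have h1 : G ≤ Real.exp 1 :=
      Real.exp_le_exp.mpr (Real.eulerMascheroniConstant_lt_two_thirds.le.trans (by norm_num))
    have h2 := Real.exp_one_lt_d9
    linarith
  set t := min (1 / 8) (ε₀ / 70) with ht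
  have ht0 : 0 < t := lt_min (by norm_num) (by positivity)
  have ht8 : t ≤ 1 / 8 := min_le_left _ _
  have ht70 : 70 * t ≤ ε₀ := by
    have := min_le_right (1 / 8 : ℝ) (ε₀ / 70)
    rw [← ht] at this
    linarith
  have ht1 : t ≤ 1 := by linarith
  have ht4 : t ≤ 1 / 4 := by linarith
  -- the three steps
  have hS := switchedSiftedCount_le (ε := t) (δ := t) (θ := t) ht0 ht1 ht0 ht8 ht0
  have hT := card_switchedTriplesExt_le (ε := t) ht0 ht1 (η := t) ht0
  obtain ⟨C, hR⟩ := switchedRemainderExt_le (ε := t) (δ := t) ht0 ht1 ht0 ht4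
  obtain ⟨N₀, hN₀⟩ := eventually_atTop.mp (hS.and (hT.and (hR.and (eventually_ge_atTop 2))))
  refine ⟨C, N₀, fun N hN hEven => ?_⟩
  obtain ⟨hSN, hTN, hRN, hN2⟩ := hN₀ N hN
  have hSN := hSN hEven
  have hN1 : (1 : ℝ) < N := by exact_mod_cast (show 1 < N by omega)
  have hN0 : (0 : ℝ) < N := by linarith
  have hlog : 0 < Real.log N := Real.log_pos hN1
  have hV0 : 0 < sieveProduct N (z N) := sieveProduct_pos hEven _
  set X : ℝ := (N : ℝ) * sieveProduct N (z N) / Real.log N with hX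
  have hX0 : 0 < X := by positivity
  set T : ℝ := (#(switchedTriplesExt N t) : ℝ) with hTdef
  have hT0 : 0 ≤ T := Nat.cast_nonneg _
  -- `T V ≤ (1+t)²(c+t) X`
  have h1 : T * sieveProduct N (z N) ≤ (1 + t) ^ 2 * (c + t) * X := by
    calc T * sieveProduct N (z N) ≤ ((1 + t) ^ 2 * (c + t) * N / Real.log N) * sieveProduct N (z N) :=
          mul_le_mul_of_nonneg_right hTN hV0.le
      _ = (1 + t) ^ 2 * (c + t) * X := by rw [hX]; ring
  -- the constant
  have hKt : G / (2 * (1 - 2 * t)) ≤ G / 2 * (1 + 4 * t) := by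
    rw [div_le_iff₀ (by linarith)]
    have h14 : (0 : ℝ) ≤ 1 - 4 * t := by linarith
    nlinarith [mul_nonneg (mul_nonneg hG0.le ht0.le) h14]
  have hK0 : 0 ≤ G / (2 * (1 - 2 * t)) + t := by
    have : 0 < 2 * (1 - 2 * t) := by linarith
    positivity
  have a1 : t * c ≤ 2 * t := by nlinarith
  have a2 : t ^ 2 ≤ t / 8 := by nlinarith
  have a3 : t ^ 2 * c ≤ 2 * t ^ 2 := by nlinarith [sq_nonneg t]
  have a4 : t ^ 3 ≤ t ^ 2 := by nlinarith [sq_nonneg t]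
  have a5 : G * t ≤ 3 * t := by nlinarith
  have hstep1 : (1 + t) ^ 2 * (c + t) ≤ c + 8 * t := by
    have e : (1 + t) ^ 2 * (c + t) = c + t + 2 * (t * c) + 2 * t ^ 2 + t ^ 2 * c + t ^ 3 := by ring
    rw [e]; linarith
  have hstep2 : G / (2 * (1 - 2 * t)) + t ≤ G / 2 + 7 * t := by
    have e : G / 2 * (1 + 4 * t) = G / 2 + 2 * (G * t) := by ring
    linarith
  have hstep3 : (G / 2 + 7 * t) * (c + 8 * t) ≤ c * G / 2 + 33 * t := by
    have e : (G / 2 + 7 * t) * (c + 8 * t) = c * G / 2 + 4 * (G * t) + 7 * (t * c) + 56 * t ^ 2 := by ring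
    rw [e]; linarith
  have hΦ : (G / (2 * (1 - 2 * t)) + t) * ((1 + t) ^ 2 * (c + t)) ≤ c * G / 2 + ε₀ / 2 := by
    have hA : 0 ≤ (1 + t) ^ 2 * (c + t) := by positivity
    have := mul_le_mul hstep2 hstep1 hA (by positivity)
    linarith
  -- main term and remainder
  have hmain : (G / (2 * (1 - 2 * t)) + t) * T * sieveProduct N (z N) ≤ (c * G / 2 + ε₀ / 2) * X := by
    calc (G / (2 * (1 - 2 * t)) + t) * T * sieveProduct N (z N)
        = (G / (2 * (1 - 2 * t)) + t) * (T * sieveProduct N (z N)) := by ring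
      _ ≤ (G / (2 * (1 - 2 * t)) + t) * ((1 + t) ^ 2 * (c + t) * X) :=
          mul_le_mul_of_nonneg_left h1 hK0
      _ = (G / (2 * (1 - 2 * t)) + t) * ((1 + t) ^ 2 * (c + t)) * X := by ring
      _ ≤ (c * G / 2 + ε₀ / 2) * X := mul_le_mul_of_nonneg_right hΦ hX0.le
  have hstrict : (c * G / 2 + ε₀ / 2) * X < (c * G / 2 + ε₀) * X := by
    have : c * G / 2 + ε₀ / 2 < c * G / 2 + ε₀ := by linarith
    exact mul_lt_mul_of_pos_right this hX0
  calc (switchedSiftedCount N (z N) (y N) : ℝ)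
      ≤ (G / (2 * (1 - 2 * t)) + t) * T * sieveProduct N (z N) +
          switchedRemainderExt N t ((N : ℝ) ^ (1 / 2 - t)) := hSN
    _ ≤ (c * G / 2 + ε₀ / 2) * X + C * N / Real.log N ^ 3 := add_le_add hmain hRN
    _ < (c * G / 2 + ε₀) * X + C * N / Real.log N ^ 3 := by linarith
    _ = (switchingConstant * Real.exp Real.eulerMascheroniConstant / 2 + ε₀) *
          ((N : ℝ) * sieveProduct N (z N) / Real.log N) + C * N / Real.log N ^ 3 := by
        rw [hc, hG, hX]

end Literature.NumberTheory.Sieve.Chen
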